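import Literature.Analysis.OperatorTheory.RieszProjectionContour
import HarnessLib

/-!
# Non-triviality of the Riesz projection passes to strong resolvent limits
  (the concluding step of Albritton–Brué–Colombo 2022, Prop. 2.6 and Thm. 3.1, bounded case)

Analysis/OperatorTheory proofs-layer file (theorems only, no definitions, no named facts),
continuing `RieszProjectionContour.lean`. Albritton–Brué–Colombo (arXiv:2112.03116) conclude the
proofs of Prop. 2.6 and Thm. 3.1 as follows: the resolvents `R(λ, T_ℓ)` converge to `R(λ, T_∞)`
*strongly* (`R(λ, T_ℓ) f → R(λ, T_∞) f` for every `f`), uniformly for `λ` on a circle `c⃗` around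
the unstable eigenvalue `λ_∞` of the limiting operator; hence the spectral projections
`Pr_ℓ = (2πi)⁻¹ ∮_{c⃗} R(λ, T_ℓ) dλ` satisfy `Pr_ℓ f → Pr_∞ f`; "since `Pr_∞` is non-trivial, we
must have that `Pr_ℓ` is non-trivial for all sufficiently large `ℓ`", and a non-trivial spectral
projection forces spectrum (there: an unstable eigenvalue) inside the curve.

For bounded operators `T n`, `Tlim` on a complex Banach space this file proves exactly this chain:

* `circleIntegral_clm_apply`: `(∮ F(z) dz) v = ∮ F(z) v dz` for a circle-integrable
  operator-valued `F` (evaluation is a continuous linear map);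
* `tendsto_circleIntegral_resolvent_apply`: strong convergence of the resolvents, uniformly on
  the circle, gives `(∮ R(z, T n) dz) f → (∮ R(z, Tlim) dz) f` (Mathlib's
  `TendstoUniformlyOn.tendsto_circleIntegral_of_continuousOn`);
* `eventually_circleIntegral_resolvent_ne_zero`, `eventually_rieszProjection_ne_zero_of_strong`:
  if `Pr_∞ ≠ 0` then `Pr_n ≠ 0` eventually;
* `eventually_spectrum_inter_ball_nonempty_of_strong`: … hence `σ(T n)` meets the open disc
  eventually (with `spectrum_inter_ball_nonempty_of_circleIntegral_ne_zero`), and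
  `eventually_spectrum_inter_ball_nonempty_of_strong_of_apply_eq_smul`: the case where the
  non-triviality of `Pr_∞` comes from an eigenvalue of `Tlim` inside the circle
  (`circleIntegral_resolvent_ne_zero_of_apply_eq_smul`).

The norm-convergence analogue is `RieszProjectionPerturbation.lean`; the unbounded operators of
[ABC] enter only through their (bounded) resolvents, which is all that is used here except for the
identification of the limit.

## References

* D. Albritton, E. Brué, M. Colombo, *Non-uniqueness of Leray solutions of the forced
  Navier–Stokes equations*, Ann. of Math. 196 (2022), arXiv:2112.03116: Lemma 2.7 and the end of
  the proof of Prop. 2.6 (§2.4), Lemma 3.4 and the proof of Thm. 3.1 (§3).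
  [AlbrittonBrueColombo2022AnnMath]
* T. Kato, *Perturbation Theory for Linear Operators* (1966), IV-§3.4 (3.11), VIII-§1
  (strong resolvent convergence). [Kato1966]
-/

noncomputable section

open Complex MeasureTheory Metric Set Filter Topology

namespace Literature.Analysis.OperatorTheory

variable {E : Type*} [NormedAddCommGroup E] [NormedSpace ℂ E] [CompleteSpace E]

/-- **Evaluation commutes with the circle integral**: for a circle-integrable operator-valued
function, `(∮ F(z) dz) v = ∮ F(z) v dz`. [folklore] -/
theorem circleIntegral_clm_apply {F : ℂ → E →L[ℂ] E} {c : ℂ} {R : ℝ}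
    (hF : CircleIntegrable F c R) (v : E) :
    (∮ z in C(c, R), F z) v = ∮ z in C(c, R), F z v := by
  have hint := (circleIntegrable_iff R).1 hF
  simp only [circleIntegral]
  rw [show (∫ θ in (0 : ℝ)..2 * Real.pi, deriv (circleMap c R) θ • F (circleMap c R θ)) v =
      (ContinuousLinearMap.apply ℂ E v)
        (∫ θ in (0 : ℝ)..2 * Real.pi, deriv (circleMap c R) θ • F (circleMap c R θ)) from rfl,
    ← ContinuousLinearMap.intervalIntegral_comp_comm _ hint]
  simp only [ContinuousLinearMap.apply_apply, smul_apply]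

/-- **Strong resolvent convergence, uniformly on the circle, gives convergence of the Riesz
integrals applied to a vector** ([ABC], proofs of Prop. 2.6 / Thm. 3.1: "`Pr_ℓ f → Pr_∞ f`").
Here `T : ι → E →L[ℂ] E` along a countably generated filter `l`, the circle lies in `ρ(Tlim)` and
eventually in `ρ(T n)`. [cite: AlbrittonBrueColombo2022AnnMath, §2.4 (end of proof of Prop. 2.6) and §3 (proof of Thm. 3.1)] -/
theorem tendsto_circleIntegral_resolvent_apply {ι : Type*} {l : Filter ι} [l.IsCountablyGenerated]
    {T : ι → E →L[ℂ] E} {Tlim : E →L[ℂ] E} {c : ℂ} {R : ℝ} (hR : 0 ≤ R)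
    (hslim : sphere c R ⊆ resolventSet ℂ Tlim) (hs : ∀ᶠ n in l, sphere c R ⊆ resolventSet ℂ (T n))
    (f : E)
    (hconv : TendstoUniformlyOn (fun n z => resolvent (T n) z f) (fun z => resolvent Tlim z f) l
      (sphere c R)) :
    Tendsto (fun n => (∮ z in C(c, R), resolvent (T n) z) f) l
      (𝓝 ((∮ z in C(c, R), resolvent Tlim z) f)) := by
  -- rewrite both sides as integrals of vector-valued functions
  have hlim : (∮ z in C(c, R), resolvent Tlim z) f = ∮ z in C(c, R), resolvent Tlim z f :=
    circleIntegral_clm_apply (((continuousOn_resolvent Tlim).mono hslim).circleIntegrable hR) f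
  have hn : ∀ᶠ n in l, (∮ z in C(c, R), resolvent (T n) z) f = ∮ z in C(c, R), resolvent (T n) z f :=
    hs.mono fun n hn =>
      circleIntegral_clm_apply (((continuousOn_resolvent (T n)).mono hn).circleIntegrable hR) f
  rw [hlim]
  refine (Filter.tendsto_congr' hn).2 ?_
  refine TendstoUniformlyOn.tendsto_circleIntegral_of_continuousOn hR ?_ hconv
  exact hs.mono fun n hn =>
    (((continuousOn_resolvent (T n)).mono hn).clm_apply continuousOn_const)

/-- **Non-triviality of the Riesz integral passes to the approximants** ([ABC]: "since `Pr_∞` is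
non-trivial, we must have that `Pr_ℓ` is non-trivial for all sufficiently large `ℓ`"): under
strong resolvent convergence uniformly on the circle (for every vector), if
`∮ R(z, Tlim) dz ≠ 0` then `∮ R(z, T n) dz ≠ 0` eventually. [cite: AlbrittonBrueColombo2022AnnMath, §2.4 (end of proof of Prop. 2.6) and §3 (proof of Thm. 3.1)] -/
theorem eventually_circleIntegral_resolvent_ne_zero {ι : Type*} {l : Filter ι}
    [l.IsCountablyGenerated] {T : ι → E →L[ℂ] E} {Tlim : E →L[ℂ] E} {c : ℂ} {R : ℝ} (hR : 0 ≤ R)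
    (hslim : sphere c R ⊆ resolventSet ℂ Tlim) (hs : ∀ᶠ n in l, sphere c R ⊆ resolventSet ℂ (T n))
    (hconv : ∀ f : E, TendstoUniformlyOn (fun n z => resolvent (T n) z f)
      (fun z => resolvent Tlim z f) l (sphere c R))
    (hne : (∮ z in C(c, R), resolvent Tlim z) ≠ 0) :
    ∀ᶠ n in l, (∮ z in C(c, R), resolvent (T n) z) ≠ 0 := by
  -- a vector on which the limiting integral is non-zero
  obtain ⟨f, hf⟩ : ∃ f : E, (∮ z in C(c, R), resolvent Tlim z) f ≠ 0 := by
    by_contra h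
    push Not at h
    exact hne (ContinuousLinearMap.ext h)
  have ht := tendsto_circleIntegral_resolvent_apply hR hslim hs f (hconv f)
  filter_upwards [ht.eventually_ne hf] with n hn h0
  exact hn (by rw [h0, zero_apply])

/-- The same for the Riesz projections `P = (2πi)⁻¹ ∮ R(z) dz`. [cite: AlbrittonBrueColombo2022AnnMath, §2.4 (end of proof of Prop. 2.6) and §3 (proof of Thm. 3.1)] -/
theorem eventually_rieszProjection_ne_zero_of_strong {ι : Type*} {l : Filter ι}
    [l.IsCountablyGenerated] {T : ι → E →L[ℂ] E} {Tlim : E →L[ℂ] E} {c : ℂ} {R : ℝ} (hR : 0 ≤ R)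
    (hslim : sphere c R ⊆ resolventSet ℂ Tlim) (hs : ∀ᶠ n in l, sphere c R ⊆ resolventSet ℂ (T n))
    (hconv : ∀ f : E, TendstoUniformlyOn (fun n z => resolvent (T n) z f)
      (fun z => resolvent Tlim z f) l (sphere c R))
    (hne : rieszProjection Tlim c R ≠ 0) :
    ∀ᶠ n in l, rieszProjection (T n) c R ≠ 0 := by
  have hne' : (∮ z in C(c, R), resolvent Tlim z) ≠ 0 := fun h0 =>
    hne (by rw [rieszProjection_def, h0, smul_zero])
  filter_upwards [eventually_circleIntegral_resolvent_ne_zero hR hslim hs hconv hne'] with n hn h0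
  have h2 : (2 * Real.pi * I : ℂ) ≠ 0 := by simp [Real.pi_ne_zero, I_ne_zero]
  apply hn
  have := congrArg (fun P => (2 * Real.pi * I : ℂ) • P) h0
  simpa [rieszProjection_def, smul_smul, mul_inv_cancel₀ h2] using this

/-- **Spectrum inside the circle for the approximants** ([ABC], conclusion of Prop. 2.6 /
Thm. 3.1, bounded case): under strong resolvent convergence uniformly on a circle lying in all
the resolvent sets, a non-trivial limiting Riesz projection forces `σ(T n) ∩ {|z − c| < R} ≠ ∅`
eventually. [cite: AlbrittonBrueColombo2022AnnMath, §2.4 (end of proof of Prop. 2.6) and §3 (proof of Thm. 3.1)] -/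
theorem eventually_spectrum_inter_ball_nonempty_of_strong {ι : Type*} {l : Filter ι}
    [l.IsCountablyGenerated] {T : ι → E →L[ℂ] E} {Tlim : E →L[ℂ] E} {c : ℂ} {R : ℝ} (hR : 0 ≤ R)
    (hslim : sphere c R ⊆ resolventSet ℂ Tlim) (hs : ∀ᶠ n in l, sphere c R ⊆ resolventSet ℂ (T n))
    (hconv : ∀ f : E, TendstoUniformlyOn (fun n z => resolvent (T n) z f)
      (fun z => resolvent Tlim z f) l (sphere c R))
    (hne : rieszProjection Tlim c R ≠ 0) :
    ∀ᶠ n in l, (spectrum ℂ (T n) ∩ ball c R).Nonempty := by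
  filter_upwards [eventually_rieszProjection_ne_zero_of_strong hR hslim hs hconv hne, hs]
    with n hn hsn
  exact spectrum_inter_ball_nonempty_of_rieszProjection_ne_zero hR hsn hn

/-- **The [ABC] pattern in full (bounded case): an eigenvalue of the limiting operator inside
the circle + strong resolvent convergence uniformly on the circle ⟹ every late approximant has
spectrum inside the circle.** [cite: AlbrittonBrueColombo2022AnnMath, §2.4 (end of proof of Prop. 2.6) and §3 (proof of Thm. 3.1)] -/
theorem eventually_spectrum_inter_ball_nonempty_of_strong_of_apply_eq_smul {ι : Type*}
    {l : Filter ι} [l.IsCountablyGenerated] {T : ι → E →L[ℂ] E} {Tlim : E →L[ℂ] E} {μ : ℂ}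
    {v : E} (hv : Tlim v = μ • v) (hv0 : v ≠ 0) {c : ℂ} {R : ℝ} (hμ : μ ∈ ball c R)
    (hslim : sphere c R ⊆ resolventSet ℂ Tlim) (hs : ∀ᶠ n in l, sphere c R ⊆ resolventSet ℂ (T n))
    (hconv : ∀ f : E, TendstoUniformlyOn (fun n z => resolvent (T n) z f)
      (fun z => resolvent Tlim z f) l (sphere c R)) :
    ∀ᶠ n in l, (spectrum ℂ (T n) ∩ ball c R).Nonempty :=
  eventually_spectrum_inter_ball_nonempty_of_strong (dist_nonneg.trans (mem_ball.1 hμ).le) hslim hs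
    hconv (rieszProjection_ne_zero_of_apply_eq_smul hv hv0 hμ hslim)

end Literature.Analysis.OperatorTheory
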